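import Summits.SmoothPoincare4.SmoothPoincare4.Theorems.CylinderEntropyCylinderRungTwoKillingFluxDefs
import Summits.SmoothPoincare4.SmoothPoincare4.Theorems.CylinderEntropyCylinderRungTwoAreaDissipation
import Literature.Geometry.Riemannian.MCFComparisonPrinciple
import Literature.Geometry.Riemannian.SphericalCylinderEntropyKernelCalculus
import Literature.Geometry.Riemannian.SphericalCylinderEntropyZonalSmooth
import HarnessLib

/-!
# Hamilton's monotonicity along a smooth cylinder flow, part 4: the typed kernel along the flow

Part 4 of the proof of the registered stub `stub_hamiltonMonotonicity` of line `killing-flux` of the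
crux `CylinderEntropy.CylinderRungTwo` (stmt-SmoothPoincare4-7631). The typed kernel
`k_{p,τ} = cylKernel p τ` of `N = S⁴ × ℝ` (`Literature/Geometry/Riemannian/SphericalCylinderEntropy*.lean`:
jointly smooth in `(τ, z) ∈ (0, ∞) × ℝ⁶`, backward heat equation
`∂_τ k = Δ_{ℝ⁶}k - D²k(n,n) - 4Dk(n) + k/(2τ)`) read along a smooth cylinder flow
`IsCylinderMCF M F ν T` with `τ = t₀ - t`:

* `fderiv_cylKernel_prod_apply` — partial derivatives of `K̃(τ, z) = k_{p,τ}(z)`: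
  `DK̃(τ, z)(r, v) = r ∂_τk + D_z k v`;
* `hamilton_kernel_identity` — **Hamilton's pointwise identity**
  `-∂_τk - H Dk(ν) - H²k + ([Δ_{ℝ⁶}k - D²k(n,n) - 4Dk(n)] - [D²k(ν,ν) - |ν'|²Dk(n)] - H Dk(ν))
   = -k (H + Dk(ν)/k)² - Q(ν)`, `Q` the Harnack quadratic form of the typed kernel along `N`
  (backward heat equation + completing the square);
* `IsCylinderMCF.meanCurvature_eq_neg_inner_deriv` (`H = -⟪∂ₜF, ν⟫`), `IsCylinderMCF.norm_normal`;
* `IsCylinderMCF.continuousOn_cylKernel_comp`, `IsCylinderMCF.hasDerivAt_cylKernel_comp` — joint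
  continuity of `(t, w) ↦ k_{p,t₀-t}(F_t w)` and of its time derivative
  `DK̃(t₀ - t, F_t w)(-1, ∂ₜF_t w)` (chain rule through the jointly smooth kernel and flow): the
  hypotheses of the transport formula of part 1;
* `IsCylinderMCF.transportIntegrand_cylKernel_eq` — the transport integrand is Hamilton's
  `-∂_τk - H Dk(ν) - H²k` (`∂ₜF = -Hν`);
* `stub_hamiltonMonotonicity_part5` — the registered sub-goal marker (Hamilton's pointwise identity).

Everything is PROVED (no `sorry`, no new definitions, no named facts).

References: R. S. Hamilton, *Monotonicity formulas for parabolic flows on manifolds*, Comm. Anal.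
Geom. 1 (1993) 127–137, §4 (proof of Thm. 4.1).
-/

-- the prescribed namespace `Summit.SmoothPoincare4.SmoothPoincare4.…` repeats `SmoothPoincare4`
set_option linter.dupNamespace false

noncomputable section

open Bundle MeasureTheory Set Function Filter Module
open scoped Manifold ContDiff ENNReal Topology RealInnerProductSpace NNReal BigOperators

namespace Summit.SmoothPoincare4.SmoothPoincare4.Cruxes.CylinderRungTwo.KillingFlux

open Literature.Geometry.Riemannian Literature.Geometry.Riemannian.EuclideanHypersurface
open Literature.Geometry.Lorentzian Literature.Geometry.Lorentzian.PseudoRiemannianMetric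
open Literature.Analysis.Calculus
open Literature.Geometry.Riemannian.SphericalCylinderEntropy (cylKernel cylDensity truncL
  contDiff_cylKernel cylKernel_pos contDiffAt_cylKernel_prod cylKernel_backward_heat)
open Literature.Geometry.Manifold.CylinderSlice (padL)

section KernelCalculus

/-- **Partial derivatives of the typed kernel as a function of `(τ, z)`**: for `τ > 0`,
`D K̃(τ, z)(r, v) = r ∂_τ k(τ, z) + D_z k(τ, ·)(z) v`, `K̃(τ, z) = cylKernel p τ z` (jointly smooth on
`(0, ∞) × ℝ⁶`, `contDiffAt_cylKernel_prod`). [folklore] -/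
theorem fderiv_cylKernel_prod_apply (p : EuclideanSpace ℝ (Fin 6)) {τ : ℝ} (hτ : 0 < τ)
    (z : EuclideanSpace ℝ (Fin 6)) (r : ℝ) (v : EuclideanSpace ℝ (Fin 6)) :
    fderiv ℝ (fun q : ℝ × EuclideanSpace ℝ (Fin 6) => cylKernel p q.1 q.2) (τ, z) (r, v) =
      r * deriv (fun τ' : ℝ => cylKernel p τ' z) τ + fderiv ℝ (cylKernel p τ) z v := by
  set K : ℝ × EuclideanSpace ℝ (Fin 6) → ℝ := fun q => cylKernel p q.1 q.2 with hK
  have hKd : HasFDerivAt K (fderiv ℝ K (τ, z)) (τ, z) :=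
    ((contDiffAt_cylKernel_prod p (q := (τ, z)) hτ).differentiableAt (by simp)).hasFDerivAt
  -- the `τ`-slice
  have h1 : HasDerivAt (fun τ' : ℝ => cylKernel p τ' z) (fderiv ℝ K (τ, z) ((1 : ℝ), (0 : EuclideanSpace ℝ (Fin 6)))) τ := by
    have hγ : HasDerivAt (fun s : ℝ => ((s, z) : ℝ × EuclideanSpace ℝ (Fin 6))) ((1 : ℝ), (0 : EuclideanSpace ℝ (Fin 6))) τ :=
      (hasDerivAt_id τ).prodMk (hasDerivAt_const τ z)
    exact hKd.comp_hasDerivAt τ hγ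
  -- the `z`-slice
  have h2 : HasFDerivAt (cylKernel p τ) ((fderiv ℝ K (τ, z)).comp
      (ContinuousLinearMap.inr ℝ ℝ (EuclideanSpace ℝ (Fin 6)))) z := by
    have hι : HasFDerivAt (fun y : EuclideanSpace ℝ (Fin 6) => ((τ, y) : ℝ × EuclideanSpace ℝ (Fin 6)))
        (ContinuousLinearMap.inr ℝ ℝ (EuclideanSpace ℝ (Fin 6))) z :=
      (hasFDerivAt_const τ z).prodMk (hasFDerivAt_id z)
    exact hKd.comp z hι
  rw [h1.deriv, h2.fderiv, ContinuousLinearMap.comp_apply, ContinuousLinearMap.inr_apply,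
    ← smul_eq_mul, ← ContinuousLinearMap.map_smul, ← map_add]
  congr 1
  ext <;> simp

/-- **Hamilton's pointwise kernel identity** (the backward heat equation of the typed kernel plus
completing the square): for `p ∈ N`, `τ > 0`, a point `z` with `k(z) ≠ 0` (`k = cylKernel p τ`), a
unit vector `ν` and any real `H`,
`-∂_τ k - H Dk(ν) - H² k + ([Δ_{ℝ⁶}k - D²k(n,n) - 4Dk(n)] - [D²k(ν,ν) - |ν'|² Dk(n)] - H Dk(ν))
 = -k (H + Dk(ν)/k)² - Q(ν)`, `Q(ν) = D²k(ν,ν) - |ν'|² Dk(n) - (Dk ν)²/k + k |ν|²/(2τ)` Hamilton's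
Harnack quadratic form along `N` (`n = (z', 0)`); the bracket is `Δ_Σ(k|_Σ)` for a hypersurface
`Σ ∋ z` of `N` with unit normal `ν` and mean curvature `H` (`cylKernel_backward_heat`:
`∂_τ k = Δ_{ℝ⁶}k - D²k(n,n) - 4Dk(n) + k/(2τ)`). [cite: Hamilton1993, §4] -/
theorem hamilton_kernel_identity (p : EuclideanSpace ℝ (Fin 6))
    (hp : ∑ i : Fin 5, p (Fin.castSucc i) ^ 2 = 1) {τ : ℝ} (hτ : 0 < τ) (z : EuclideanSpace ℝ (Fin 6))
    (hk : cylKernel p τ z ≠ 0) (ν : EuclideanSpace ℝ (Fin 6)) (hν : ‖ν‖ = 1) (H : ℝ) :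
    -deriv (fun τ' : ℝ => cylKernel p τ' z) τ - H * fderiv ℝ (cylKernel p τ) z ν
        - H ^ 2 * cylKernel p τ z
      + (((∑ i : Fin 6, iteratedFDeriv ℝ 2 (cylKernel p τ) z
              ![EuclideanSpace.single i (1 : ℝ), EuclideanSpace.single i (1 : ℝ)])
            - iteratedFDeriv ℝ 2 (cylKernel p τ) z ![padL (truncL z), padL (truncL z)]
            - 4 * fderiv ℝ (cylKernel p τ) z (padL (truncL z)))
          - (iteratedFDeriv ℝ 2 (cylKernel p τ) z ![ν, ν]
            - (∑ i : Fin 5, ν (Fin.castSucc i) ^ 2) * fderiv ℝ (cylKernel p τ) z (padL (truncL z)))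
          - H * fderiv ℝ (cylKernel p τ) z ν)
      = -(cylKernel p τ z * (H + fderiv ℝ (cylKernel p τ) z ν / cylKernel p τ z) ^ 2)
          - (iteratedFDeriv ℝ 2 (cylKernel p τ) z ![ν, ν]
              - (∑ i : Fin 5, ν (Fin.castSucc i) ^ 2) * fderiv ℝ (cylKernel p τ) z (padL (truncL z))
              - (fderiv ℝ (cylKernel p τ) z ν) ^ 2 / cylKernel p τ z
              + cylKernel p τ z * ‖ν‖ ^ 2 / (2 * τ)) := by
  rw [cylKernel_backward_heat p hp hτ z, hν]
  field_simp
  ring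

end KernelCalculus

section Flow

variable {M : Type} [TopologicalSpace M] [ChartedSpace (EuclideanSpace ℝ (Fin 4)) M]
  [IsManifold (𝓡 4) ∞ M] {F ν : ℝ → M → EuclideanSpace ℝ (Fin 6)} {T : ℝ}

/-- `H = -⟪∂ₜF, ν⟫` along a cylinder flow (`∂ₜF = -Hν`, `‖ν‖ = 1`). [folklore] -/
theorem IsCylinderMCF.meanCurvature_eq_neg_inner_deriv (h : IsCylinderMCF M F ν T) {t : ℝ}
    (ht : T ≤ t) (y : M) :
    (euclideanMetric (EuclideanSpace ℝ (Fin 6))).meanCurvature (F t) contMDiff_pullbackBilin_holds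
        (h.isSpacelikeImmersion t ht) (ν t) y = -⟪deriv (fun s => F s y) t, ν t y⟫ := by
  set w : EuclideanSpace ℝ (Fin 6) := ν t y with hw
  set H₁ : ℝ := (euclideanMetric (EuclideanSpace ℝ (Fin 6))).meanCurvature (F t)
    contMDiff_pullbackBilin_holds (h.isSpacelikeImmersion t ht) (ν t) y with hH₁
  have hv : deriv (fun s => F s y) t = (-H₁) • w := h.deriv_slice_eq ht y
  have hν : ⟪w, w⟫ = (1 : ℝ) := by
    have := (h.isUnitNormal t ht).val_self y
    rwa [euclideanMetric_apply] at this
  rw [hv, real_inner_smul_left, hν]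
  ring

/-- `‖ν‖ = 1` along a cylinder flow. [folklore] -/
theorem IsCylinderMCF.norm_normal (h : IsCylinderMCF M F ν T) {t : ℝ} (ht : T ≤ t) (y : M) :
    ‖ν t y‖ = 1 := by
  have hν : ⟪ν t y, ν t y⟫ = (1 : ℝ) := by
    have := (h.isUnitNormal t ht).val_self y
    rwa [euclideanMetric_apply] at this
  rw [real_inner_self_eq_norm_sq] at hν
  nlinarith [norm_nonneg (ν t y)]

/-- **The typed kernel along a cylinder flow is jointly continuous**: for `S ⊆ [T, ∞) ∩ (-∞, t₀)`,
`(t, w) ↦ k_{p, t₀ - t}(F_t w)` is continuous on `S × M`. [folklore] -/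
theorem IsCylinderMCF.continuousOn_cylKernel_comp (h : IsCylinderMCF M F ν T)
    (p : EuclideanSpace ℝ (Fin 6)) (t₀ : ℝ) {S : Set ℝ} (hS : S ⊆ Ici T) (hS' : S ⊆ Iio t₀) :
    ContinuousOn (uncurry fun t w => cylKernel p (t₀ - t) (F t w)) (S ×ˢ univ) := by
  obtain ⟨U, hU, hIU, hF⟩ := h.contMDiffOn
  have hK : ContinuousOn (fun q : ℝ × EuclideanSpace ℝ (Fin 6) => cylKernel p q.1 q.2)
      (Ioi 0 ×ˢ univ) := fun q hq => (contDiffAt_cylKernel_prod p hq.1).continuousAt.continuousWithinAt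
  have hψ : ContinuousOn (fun q : ℝ × M => ((t₀ - q.1, F q.1 q.2) : ℝ × EuclideanSpace ℝ (Fin 6)))
      (S ×ˢ univ) :=
    ((continuous_const.sub continuous_fst).continuousOn).prodMk
      (hF.continuousOn.mono (Set.prod_mono (hS.trans hIU) subset_rfl))
  refine hK.comp hψ fun q hq => ⟨?_, mem_univ _⟩
  have := hS' hq.1
  simp only [mem_Iio] at this
  simp only [mem_Ioi, sub_pos]
  exact this

/-- **The typed kernel along a cylinder flow: time derivative and its continuity** on a time
interval `(a, b)` with `T < a`, `b ≤ t₀`: with `K̃(τ, z) = k_{p,τ}(z)`,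
`∂ₜ [k_{p,t₀-t}(F_t w)] = DK̃(t₀ - t, F_t w)(-1, ∂ₜF_t w)`, jointly continuous in `(t, w)`
(chain rule through the jointly smooth kernel and the jointly smooth flow). [folklore] -/
theorem IsCylinderMCF.hasDerivAt_cylKernel_comp (h : IsCylinderMCF M F ν T)
    (p : EuclideanSpace ℝ (Fin 6)) {a b t₀ : ℝ} (ha : T < a) (hb : b ≤ t₀) :
    ContinuousOn (uncurry fun t w => fderiv ℝ (fun q : ℝ × EuclideanSpace ℝ (Fin 6) => cylKernel p q.1 q.2)
        (t₀ - t, F t w) (-1, deriv (fun s => F s w) t)) (Ioo a b ×ˢ univ) ∧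
      ∀ t ∈ Ioo a b, ∀ w, HasDerivAt (fun s => cylKernel p (t₀ - s) (F s w))
        (fderiv ℝ (fun q : ℝ × EuclideanSpace ℝ (Fin 6) => cylKernel p q.1 q.2)
          (t₀ - t, F t w) (-1, deriv (fun s => F s w) t)) t := by
  obtain ⟨U, hU, hIU, hF⟩ := h.contMDiffOn
  have hIooU : Ioo a b ⊆ U := fun t ht => hIU (mem_Ici.2 (ha.le.trans ht.1.le))
  have hpos : ∀ t ∈ Ioo a b, 0 < t₀ - t := fun t ht => by linarith [ht.2]
  set K : ℝ × EuclideanSpace ℝ (Fin 6) → ℝ := fun q => cylKernel p q.1 q.2 with hKdef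
  have hKs : ContDiffOn ℝ ∞ K (Ioi 0 ×ˢ univ) := fun q hq =>
    (contDiffAt_cylKernel_prod p hq.1).contDiffWithinAt
  have hopen : IsOpen (Ioi (0 : ℝ) ×ˢ (univ : Set (EuclideanSpace ℝ (Fin 6)))) :=
    isOpen_Ioi.prod isOpen_univ
  have hDK : ContinuousOn (fderiv ℝ K) (Ioi 0 ×ˢ univ) :=
    hKs.continuousOn_fderiv_of_isOpen hopen (by simp)
  have hψ : ContinuousOn (fun q : ℝ × M => ((t₀ - q.1, F q.1 q.2) : ℝ × EuclideanSpace ℝ (Fin 6)))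
      (Ioo a b ×ˢ univ) :=
    ((continuous_const.sub continuous_fst).continuousOn).prodMk
      (hF.continuousOn.mono (Set.prod_mono hIooU subset_rfl))
  have hmaps : MapsTo (fun q : ℝ × M => ((t₀ - q.1, F q.1 q.2) : ℝ × EuclideanSpace ℝ (Fin 6)))
      (Ioo a b ×ˢ univ) (Ioi 0 ×ˢ univ) := fun q hq => ⟨hpos q.1 hq.1, mem_univ _⟩
  refine ⟨?_, fun t ht w => ?_⟩
  · have hV : ContinuousOn (fun q : ℝ × M => ((-1 : ℝ), deriv (fun s => F s q.2) q.1))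
        (Ioo a b ×ˢ univ) :=
      continuousOn_const.prodMk ((continuousOn_timeDeriv hU hF).mono (Set.prod_mono hIooU subset_rfl))
    exact (hDK.comp hψ hmaps).clm_apply hV
  · have hKd : HasFDerivAt K (fderiv ℝ K (t₀ - t, F t w)) (t₀ - t, F t w) :=
      ((contDiffAt_cylKernel_prod p (q := (t₀ - t, F t w)) (hpos t ht)).differentiableAt
        (by simp)).hasFDerivAt
    have hγ : HasDerivAt (fun s : ℝ => ((t₀ - s, F s w) : ℝ × EuclideanSpace ℝ (Fin 6)))
        ((-1 : ℝ), deriv (fun s => F s w) t) t :=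
      ((hasDerivAt_id t).const_sub t₀).prodMk (hasDerivAt_slice hU hF (hIooU ht) w)
    exact hKd.comp_hasDerivAt t hγ

/-- **The transport integrand of the typed kernel is Hamilton's**: at a time `t > T` with
`τ = t₀ - t > 0`, `DK̃(τ, F_t w)(-1, ∂ₜF_t w) - H² k = -∂_τ k - H Dk(ν) - H² k` at `z = F_t w`
(`∂ₜF = -Hν`). [cite: Hamilton1993, §4] -/
theorem IsCylinderMCF.transportIntegrand_cylKernel_eq (h : IsCylinderMCF M F ν T)
    (p : EuclideanSpace ℝ (Fin 6)) {t t₀ : ℝ} (ht : T ≤ t) (htt₀ : t < t₀) (w : M) :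
    fderiv ℝ (fun q : ℝ × EuclideanSpace ℝ (Fin 6) => cylKernel p q.1 q.2)
          (t₀ - t, F t w) (-1, deriv (fun s => F s w) t)
        - ((euclideanMetric (EuclideanSpace ℝ (Fin 6))).meanCurvature (F t)
            contMDiff_pullbackBilin_holds (h.isSpacelikeImmersion t ht) (ν t) w) ^ 2 *
          cylKernel p (t₀ - t) (F t w) =
      -deriv (fun τ' : ℝ => cylKernel p τ' (F t w)) (t₀ - t)
        - (euclideanMetric (EuclideanSpace ℝ (Fin 6))).meanCurvature (F t)
            contMDiff_pullbackBilin_holds (h.isSpacelikeImmersion t ht) (ν t) w *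
          fderiv ℝ (cylKernel p (t₀ - t)) (F t w) (ν t w)
        - ((euclideanMetric (EuclideanSpace ℝ (Fin 6))).meanCurvature (F t)
            contMDiff_pullbackBilin_holds (h.isSpacelikeImmersion t ht) (ν t) w) ^ 2 *
          cylKernel p (t₀ - t) (F t w) := by
  rw [fderiv_cylKernel_prod_apply p (sub_pos.2 htt₀), h.deriv_slice_eq ht w, map_smul, smul_eq_mul]
  ring

end Flow


/-- **Registered sub-goal marker `stub_hamiltonMonotonicity_part5` (Hamilton's pointwise kernel
identity).** For `p ∈ N`, `τ > 0`, `z` with `k(z) ≠ 0` (`k = cylKernel p τ`), a unit vector `ν` and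
any real `H`: `-∂_τk - H Dk(ν) - H²k + Δ_Σ-bracket = -k (H + Dk(ν)/k)² - Q(ν)`
(`hamilton_kernel_identity`). [cite: Hamilton1993, §4] -/
theorem stub_hamiltonMonotonicity_part5 :
    ∀ (p : EuclideanSpace ℝ (Fin 6)), ∑ i : Fin 5, p (Fin.castSucc i) ^ 2 = 1 → ∀ (τ : ℝ), 0 < τ → ∀ (z : EuclideanSpace ℝ (Fin 6)), Literature.Geometry.Riemannian.SphericalCylinderEntropy.cylKernel p τ z ≠ 0 → ∀ (ν : EuclideanSpace ℝ (Fin 6)), ‖ν‖ = 1 → ∀ (H : ℝ), -deriv (fun τ' : ℝ => Literature.Geometry.Riemannian.SphericalCylinderEntropy.cylKernel p τ' z) τ - H * fderiv ℝ (Literature.Geometry.Riemannian.SphericalCylinderEntropy.cylKernel p τ) z ν - H ^ 2 * Literature.Geometry.Riemannian.SphericalCylinderEntropy.cylKernel p τ z + (((∑ i : Fin 6, iteratedFDeriv ℝ 2 (Literature.Geometry.Riemannian.SphericalCylinderEntropy.cylKernel p τ) z ![EuclideanSpace.single i (1 : ℝ), EuclideanSpace.single i (1 : ℝ)]) - iteratedFDeriv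 ℝ 2 (Literature.Geometry.Riemannian.SphericalCylinderEntropy.cylKernel p τ) z ![Literature.Geometry.Manifold.CylinderSlice.padL (Literature.Geometry.Riemannian.SphericalCylinderEntropy.truncL z), Literature.Geometry.Manifold.CylinderSlice.padL (Literature.Geometry.Riemannian.SphericalCylinderEntropy.truncL z)] - 4 * fderiv ℝ (Literature.Geometry.Riemannian.SphericalCylinderEntropy.cylKernel p τ) z (Literature.Geometry.Manifold.CylinderSlice.padL (Literature.Geometry.Riemannian.SphericalCylinderEntropy.truncL z))) - (iteratedFDeriv ℝ 2 (Literature.Geometry.Riemannian.SphericalCylinderEntropy.cylKernel p τ) z ![ν, ν] - (∑ i : Fin 5, ν (Fin.castSucc i) ^ 2) * fderiv ℝ (Literature.Geometry.Riemannian.SphericalCylinderEntropy.cylKernel p τ) z (Literature.Geometry.Manifold.CylinderSlice.padL (Literature.Geometry.Riemannian.SphericalCylinderEntropy.truncL z))) - H * fderiv ℝ (Literature.Geometry.Riemannian.SphericalCylinderEntropy.cylKernel p τ) z ν) = -(Literature.Geometry.Riemannian.SphericalCylinderEntropy.cylKernel p τ z * (H + fderiv ℝ (Literature.Geometry.Riemannian.SphericalCylinderEntropy.cylKernel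 p τ) z ν / Literature.Geometry.Riemannian.SphericalCylinderEntropy.cylKernel p τ z) ^ 2) - (iteratedFDeriv ℝ 2 (Literature.Geometry.Riemannian.SphericalCylinderEntropy.cylKernel p τ) z ![ν, ν] - (∑ i : Fin 5, ν (Fin.castSucc i) ^ 2) * fderiv ℝ (Literature.Geometry.Riemannian.SphericalCylinderEntropy.cylKernel p τ) z (Literature.Geometry.Manifold.CylinderSlice.padL (Literature.Geometry.Riemannian.SphericalCylinderEntropy.truncL z)) - (fderiv ℝ (Literature.Geometry.Riemannian.SphericalCylinderEntropy.cylKernel p τ) z ν) ^ 2 / Literature.Geometry.Riemannian.SphericalCylinderEntropy.cylKernel p τ z + Literature.Geometry.Riemannian.SphericalCylinderEntropy.cylKernel p τ z * ‖ν‖ ^ 2 / (2 * τ)) :=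
  fun p hp _ hτ z hk ν hν H => hamilton_kernel_identity p hp hτ z hk ν hν H

end Summit.SmoothPoincare4.SmoothPoincare4.Cruxes.CylinderRungTwo.KillingFlux

end
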